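import Literature.MathematicalPhysics.QuantumLattice.TypeClassSidecarReaderAllTori
import Literature.MathematicalPhysics.QuantumLattice.HubbardTTPrimeDiagHopTransportThermal
import HarnessLib

/-!
# Kernel reader: `t–t'` temperature cells from a «c2-sector» sidecar AT `t'` and a Markov (C1) certificate at `t' = 0`,
# transported along `t'` at the kinematic price `β_h |t'| · 16/π²` — every torus limit

Family `hubbard` (topic `MathematicalPhysics/QuantumLattice`). The cuprate-box (`t' = −1/4`) temperature axis of the
hubbard-thermal cell had, until now, only the infinite-temperature hot anchor (`TypeClassSidecarReaderTTPrime`,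
`…le_of_c2Check_infT_seven_eighths`: `e ≤ (2H_b(n/2) − W)/β`) because no Markov (C1) certificate exists at `t' ≠ 0`.
But a C1 certificate at `t' = 0` IS a hot input at every `t'`: the sector free energy is Lipschitz in the diagonal
hopping with the KINEMATIC constant `16/π²` per site and unit `t'` (`HubbardTTPrimeDiagHopTransportThermal`,
`eventually_log_partitionFn_sector_le_mul_sq_of_tPrime_sixteen_div_pi_sq`: the thermal diagonal-hopping energy density is
`≤ 16/π²` in absolute value for every torus limit, and the Peierls–Bogoliubov bracket integrates it), so
`log Z_{β_h}(t, t', U) ≤ (u + β_h |t'| 16/π² + ε) L²` eventually whenever `log Z_{β_h}(t, 0, U) ≤ (u + ε') L²` eventually.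
Only the HOT input is transported; the cold input is taken at `t'` itself (the «c2-sector» floor, or the `T = 0` row), so
the price enters once, multiplied by the small `β_h`, and divided by `β − β_h`:

* `eventually_log_partitionFn_sector_le_of_tPrime_anchor_ceiling`: the `(u + ε)`-shaped hot input moves from `s₀` to `s` at
  the price `β_h |s − s₀| 16/π²` (ε-management around the tree's transport lemma).
* `IsTorusLimitOfMixture.meanEnergy_hubbardTTPrime_le_of_c2Check_of_rectMarkovCertificate_tPrimeTransport_allTori`: checked
  sidecar at `(β, t, t', U)` (claim node on `hubbardOpenBoxTT' a b t t' U`, density `n (q a b) = 2A₀`) + rectangle C1 certificate at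
  `(β_h, t, 0, U, μ)` ⇒ `e_Φ(ω) ≤ ((c − β_h μ n) + β_h |t'| 16/π² − Wnum/Wden)/(β − β_h)` for EVERY torus limit at `(β, t, t', U, n)`.
* `IsTorusLimitOfMixture.meanEnergy_hubbardTTPrime_le_of_energyDensity_le_of_rectMarkovCertificate_tPrimeTransport`: the cold
  cell version with the `T = 0` row `e(t, t', U, n) ≤ e⁺` as cold input ⇒ `e_Φ(ω) ≤ ((c − β_h μ n) + β_h |t'| 16/π² + β e⁺)/(β − β_h)`.
* `sixteen_div_pi_sq_lt` : `16/π² < 16212/10000` (the rational the row files use).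

At `(U, n, t') = (8, 7/8, −1/4)` with hubbard-thermal-eng-2's `t' = 0` certificates this replaces the `β = 0` anchor by
`β_h ∈ {1/8, …, 5/8}` and improves every cuprate-box cell by `0.05–0.11·t` (row files `HubbardSquare_n7o8_tpm1o4_thermal_axis_*`).
[cite: Lieb1973, §V (5.2)–(5.4)] [cite: LiebLoss1993, §8, Theorem 8.2] [cite: Israel1979, Lemma II.3.1] [cite: Ruelle1969, §3.3]
[cite: PoulinHastings2011, eqs. (3)–(8)] [cite: CoverThomas2006, Theorem 11.1.3]. Everything is PROVED; no definition, no named fact.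
-/

noncomputable section

namespace Literature.MathematicalPhysics.QuantumLattice

open Matrix Finset HubbardWave0 ThermodynamicLimit LiebThm1 AndersonCluster Literature.Probability.LatticeModels
open _root_.Filter
open scoped _root_.Topology ComplexOrder BigOperators

/-- **The transport constant as a decimal**: `16/π² < 1.6212` (from `3.141592 < π`).
[cite: LiebLoss1993, §8, Theorem 8.2] -/
theorem sixteen_div_pi_sq_lt : 16 / Real.pi ^ 2 < (16212 / 10000 : ℝ) := by
  have hπ := Real.pi_gt_d6
  have hπ0 : 0 < Real.pi := Real.pi_pos
  have h2 : (3.141592 : ℝ) ^ 2 < Real.pi ^ 2 := by nlinarith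
  rw [div_lt_iff₀ (by positivity)]
  nlinarith

namespace InfVolFermionState

variable {t t' U n β : ℝ} {ω : InfVolFermionState 2} {Ls : ℕ → ℕ}

/-- **Transport of an `(u + ε)`-shaped hot input along `t'`** (kinematic price `16/π²`): if for every `ε > 0` eventually
`log Z_{L,β_h}(t, s₀, U) ≤ (u + ε) L²` (`β_h > 0`, `0 ≤ n < 2`), then for every `ε > 0` eventually
`log Z_{L,β_h}(t, s, U) ≤ (u + β_h |s − s₀| 16/π² + ε) L²`.
[cite: Lieb1973, §V (5.2)–(5.4)] [cite: LiebLoss1993, §8, Theorem 8.2] -/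
theorem eventually_log_partitionFn_sector_le_of_tPrime_anchor_ceiling (hn0 : 0 ≤ n) (hn2 : n < 2) (t U : ℝ)
    {βh : ℝ} (hβh : 0 < βh) (s₀ s : ℝ) (hLs : Tendsto Ls atTop atTop) {u : ℝ}
    (hu : ∀ ε : ℝ, 0 < ε → ∀ᶠ j in atTop,
      Real.log (partitionFn βh (sectorHamiltonianTT' t s₀ U n (Ls j))).re ≤ (u + ε) * (Ls j : ℝ) ^ 2) :
    ∀ ε : ℝ, 0 < ε → ∀ᶠ j in atTop,
      Real.log (partitionFn βh (sectorHamiltonianTT' t s U n (Ls j))).re ≤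
        (u + βh * |s - s₀| * (16 / Real.pi ^ 2) + ε) * (Ls j : ℝ) ^ 2 := by
  intro ε hε
  have hK : 0 ≤ βh * |s - s₀| := mul_nonneg hβh.le (abs_nonneg _)
  -- `ε₂` with `βh |s − s₀| ε₂ ≤ ε/2`
  set ε₂ : ℝ := ε / 2 / (βh * |s - s₀| + 1) with hε₂
  have hε₂pos : 0 < ε₂ := by positivity
  have hsmall : βh * |s - s₀| * ε₂ ≤ ε / 2 := by
    have hden : 0 < βh * |s - s₀| + 1 := by positivity
    have : βh * |s - s₀| * ε₂ = (ε / 2) * (βh * |s - s₀| / (βh * |s - s₀| + 1)) := by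
      rw [hε₂]; field_simp
    rw [this]
    have hfrac : βh * |s - s₀| / (βh * |s - s₀| + 1) ≤ 1 := by
      rw [div_le_one hden]; linarith
    nlinarith [hε.le]
  have h := eventually_log_partitionFn_sector_le_mul_sq_of_tPrime_sixteen_div_pi_sq hn0 hn2 t U hβh s₀ s hLs
    (hu (ε / 2) (by positivity)) hε₂pos
  filter_upwards [h] with j hj
  refine hj.trans (mul_le_mul_of_nonneg_right ?_ (by positivity))
  nlinarith [hsmall, hK]

/-- **Upper edge at `t'` from a checked «c2-sector» sidecar AT `(β, t, t', U)` and a rectangle Markov certificate at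
`(β_h, t, 0, U)`, hot input transported along `t'` at the kinematic price — EVERY sequence of tori.** `ω` a torus limit of the
canonical sector Gibbs states at `(β, t, t', U, n)` (`0 ≤ n < 2`), `0 < β_h < β`; sidecar `rows` for the open `a × b` box of the
`t–t'` model passing `c2Check P K q A₀ a b rows Wnum Wden` with `n (q a b) = 2 A₀` and its claim node; C1 data on `rectWindow a' b'`
at `(β_h, μ)` for the `t' = 0` model (`cornerEnergyRep`) with constant `c`. Then
`e_Φ(ω) ≤ ((c − β_h μ n) + β_h |t'| 16/π² − Wnum/Wden)/(β − β_h)`.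
[cite: Israel1979, Lemma II.3.1] [cite: PoulinHastings2011, eqs. (3)–(8)] [cite: Ruelle1969, §3.3] [cite: Lieb1973, §V (5.2)–(5.4)] -/
theorem IsTorusLimitOfMixture.meanEnergy_hubbardTTPrime_le_of_c2Check_of_rectMarkovCertificate_tPrimeTransport_allTori
    (hn0 : 0 ≤ n) (hn2 : n < 2)
    (h : ω.IsTorusLimitOfMixture (sectorGibbsCount n) (fun L => sectorGibbsWeightTT' β t t' U n L)
      (fun L => sectorGibbsVectorTT' t t' U n L) Ls)
    (hLs : Tendsto Ls atTop atTop) {βh : ℝ} (hβh : 0 < βh) (hlt : βh < β)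
    -- C2 sidecar at `(β, t, t', U)`
    {a b : ℕ} (ha : 1 ≤ a) (hb : 1 ≤ b) {rows : List C2Row} {P K q A₀ : ℕ} {Wnum : ℤ} {Wden : ℕ}
    (hcheck : c2Check P K q A₀ a b rows Wnum Wden = true) (hn : n * ((q : ℝ) * a * b) = 2 * A₀)
    (hnode : ∀ r ∈ rows, r.floor ≤ (partitionFn β (spinSectorHamiltonian r.nu r.nd (hubbardOpenBoxTT' a b t t' U))).re)
    -- C1 at `(βh, t, 0, U)`
    (μ : ℝ) {a' b' : ℕ} (ha' : 2 ≤ a') (hb' : 2 ≤ b')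
    {ι : Type*} (sι : Finset ι) (Sw : ι → Finset (Site 2)) (hS : ∀ i, Sw i ⊆ rectWindow a' b') (zw : ι → Site 2)
    (hzw : ∀ i, shiftSet (zw i) (Sw i) ⊆ rectWindow a' b') {O : ∀ i, FermionOp (Sw i)}
    (hO : ∀ i ∈ sι, (O i).IsHermitian) (g : ι → ℝ)
    {LB : FermionOp ((rectWindow a' b').erase (mkSite2 (a' - 1) (b' - 1)))} (hLB : LB.IsHermitian) {c : ℝ}
    (hcert : ((Real.exp c : ℂ) • cfc Real.exp LB -
      fermionPartialTrace (PolySite.incl (Finset.erase_subset (mkSite2 (a' - 1) (b' - 1)) (rectWindow a' b')))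
        (cfc Real.exp (-((βh : ℂ) • (cornerEnergyRep (rectWindow a' b') (mkSite2 (a' - 1) (b' - 1)) t U μ +
            windowAnnihilator sι (rectWindow a' b') Sw hS zw hzw O g)) +
          fermionEmbed (PolySite.incl (Finset.erase_subset (mkSite2 (a' - 1) (b' - 1)) (rectWindow a' b'))) LB))).PosSemidef) :
    ω.meanEnergy (hubbardTTPrimeFermionInteraction t t' U) 1 ≤
      ((c - βh * μ * n) + βh * |t'| * (16 / Real.pi ^ 2) - (Wnum : ℝ) / Wden) / (β - βh) := by
  obtain ⟨hnd, hq, hmS, hsum, hA, hB, hz0, harith⟩ := c2Check_sound hcheck ha hb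
  have hz := c2Floor_le_of_rows hnd
    (F := fun s => (partitionFn β (spinSectorHamiltonian s.1 s.2 (hubbardOpenBoxTT' a b t t' U))).re)
    (fun r hr => hnode r hr)
  have hβ : 0 ≤ β := (hβh.trans hlt).le
  have hKTI : ∀ (L : ℕ) [NeZero L], ∀ w : TorusSite 2 L,
      relabel (Orb.translate w) (hubbardTorusTT' L t 0 U - (μ : ℂ) • totalNumber) =
        hubbardTorusTT' L t 0 U - (μ : ℂ) • totalNumber := fun L _ w => by
    rw [hubbardTorusTT'_zero_sub_mu, relabel_translate_hubbardTorusWith]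
  -- the `t' = 0` hot input in `(u + ε)` shape, then transported to `t'`
  have hu0 : ∀ ε : ℝ, 0 < ε → ∀ᶠ j in atTop,
      Real.log (partitionFn βh (sectorHamiltonianTT' t 0 U n (Ls j))).re ≤ ((c - βh * μ * n) + ε) * (Ls j : ℝ) ^ 2 :=
    fun ε hε => eventually_log_partitionFn_sectorHamiltonianTT'_le_of_clusterCertificate t U μ βh hn0 hn2.le hLs
      (rectCorner_mem_rectWindow (by omega) (by omega)) toLex_le_toLex_rectCorner
      (rectWindow_subset_halfOpenBox_max a' b')
      (fun i => bondWeightSum_cornerBondWeight (rectCorner_mem_rectWindow (by omega) (by omega))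
        (rectCorner_sub_unitVec_mem_rectWindow ha' hb' i))
      (siteWeightSum_cornerSiteWeight (rectCorner_mem_rectWindow (by omega) (by omega)))
      (siteWeightSum_mul_cornerSiteWeight (rectCorner_mem_rectWindow (by omega) (by omega)) (-μ))
      (isHermitian_windowAnnihilator sι _ Sw hS zw hzw hO g)
      (fun L _ hL3 hℓL => trace_window_mul_windowAnnihilator (relabel_translate_gibbsDensity L (hKTI L) βh)
        _ sι Sw hS zw hzw O g) hLB hcert hε
  have hu := eventually_log_partitionFn_sector_le_of_tPrime_anchor_ceiling hn0 hn2 t U hβh 0 t' hLs hu0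
  rw [sub_zero] at hu
  have hmain := h.meanEnergy_hubbardTTPrime_le_of_eventually_pressure_bounds hn0 hn2.le hLs hβh hlt
    (fun ε hε => eventually_typeFreeEntropy_mul_sq_le_log_partitionFn_allTori t t' U n hβ ha hb
      (c2Sectors rows) (c2Type rows) hq hmS hsum hA hB hn hn2.le hz0 hz hLs hε) hu
  refine hmain.trans (div_le_div_of_nonneg_right ?_ (by linarith))
  linarith

/-- **The cold-cell version: `T = 0` row as cold input.** `ω` a torus limit of the canonical sector Gibbs states at
`(β, t, t', U, n)` (`U ≥ 0`, `0 ≤ n < 2`), `0 < β_h < β`; a `T = 0` row `e(t, t', U, n) ≤ e⁺` (same `t'`); C1 data on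
`rectWindow a' b'` at `(β_h, μ)` for the `t' = 0` model with constant `c`. Then
`e_Φ(ω) ≤ ((c − β_h μ n) + β_h |t'| 16/π² + β e⁺)/(β − β_h)` (zero-entropy cold input, transported Markov hot input).
[cite: Israel1979, Lemma II.3.1] [cite: PoulinHastings2011, eqs. (3)–(8)] [cite: Ruelle1969, §3.4] [cite: Lieb1973, §V (5.2)–(5.4)] -/
theorem IsTorusLimitOfMixture.meanEnergy_hubbardTTPrime_le_of_energyDensity_le_of_rectMarkovCertificate_tPrimeTransport
    (hU : 0 ≤ U) (hn0 : 0 ≤ n) (hn2 : n < 2)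
    (h : ω.IsTorusLimitOfMixture (sectorGibbsCount n) (fun L => sectorGibbsWeightTT' β t t' U n L)
      (fun L => sectorGibbsVectorTT' t t' U n L) Ls)
    (hLs : Tendsto Ls atTop atTop) {βh : ℝ} (hβh : 0 < βh) (hlt : βh < β)
    -- `T = 0` row at `(t, t', U, n)`
    {eup : ℝ} (he : energyDensityTT' t t' U n ≤ eup)
    -- C1 at `(βh, t, 0, U)`
    (μ : ℝ) {a' b' : ℕ} (ha' : 2 ≤ a') (hb' : 2 ≤ b')
    {ι : Type*} (sι : Finset ι) (Sw : ι → Finset (Site 2)) (hS : ∀ i, Sw i ⊆ rectWindow a' b') (zw : ι → Site 2)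
    (hzw : ∀ i, shiftSet (zw i) (Sw i) ⊆ rectWindow a' b') {O : ∀ i, FermionOp (Sw i)}
    (hO : ∀ i ∈ sι, (O i).IsHermitian) (g : ι → ℝ)
    {LB : FermionOp ((rectWindow a' b').erase (mkSite2 (a' - 1) (b' - 1)))} (hLB : LB.IsHermitian) {c : ℝ}
    (hcert : ((Real.exp c : ℂ) • cfc Real.exp LB -
      fermionPartialTrace (PolySite.incl (Finset.erase_subset (mkSite2 (a' - 1) (b' - 1)) (rectWindow a' b')))
        (cfc Real.exp (-((βh : ℂ) • (cornerEnergyRep (rectWindow a' b') (mkSite2 (a' - 1) (b' - 1)) t U μ +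
            windowAnnihilator sι (rectWindow a' b') Sw hS zw hzw O g)) +
          fermionEmbed (PolySite.incl (Finset.erase_subset (mkSite2 (a' - 1) (b' - 1)) (rectWindow a' b'))) LB))).PosSemidef) :
    ω.meanEnergy (hubbardTTPrimeFermionInteraction t t' U) 1 ≤
      ((c - βh * μ * n) + βh * |t'| * (16 / Real.pi ^ 2) + β * eup) / (β - βh) := by
  have hβ : 0 < β := hβh.trans hlt
  have hKTI : ∀ (L : ℕ) [NeZero L], ∀ w : TorusSite 2 L,
      relabel (Orb.translate w) (hubbardTorusTT' L t 0 U - (μ : ℂ) • totalNumber) =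
        hubbardTorusTT' L t 0 U - (μ : ℂ) • totalNumber := fun L _ w => by
    rw [hubbardTorusTT'_zero_sub_mu, relabel_translate_hubbardTorusWith]
  have hu0 : ∀ ε : ℝ, 0 < ε → ∀ᶠ j in atTop,
      Real.log (partitionFn βh (sectorHamiltonianTT' t 0 U n (Ls j))).re ≤ ((c - βh * μ * n) + ε) * (Ls j : ℝ) ^ 2 :=
    fun ε hε => eventually_log_partitionFn_sectorHamiltonianTT'_le_of_clusterCertificate t U μ βh hn0 hn2.le hLs
      (rectCorner_mem_rectWindow (by omega) (by omega)) toLex_le_toLex_rectCorner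
      (rectWindow_subset_halfOpenBox_max a' b')
      (fun i => bondWeightSum_cornerBondWeight (rectCorner_mem_rectWindow (by omega) (by omega))
        (rectCorner_sub_unitVec_mem_rectWindow ha' hb' i))
      (siteWeightSum_cornerSiteWeight (rectCorner_mem_rectWindow (by omega) (by omega)))
      (siteWeightSum_mul_cornerSiteWeight (rectCorner_mem_rectWindow (by omega) (by omega)) (-μ))
      (isHermitian_windowAnnihilator sι _ Sw hS zw hzw hO g)
      (fun L _ hL3 hℓL => trace_window_mul_windowAnnihilator (relabel_translate_gibbsDensity L (hKTI L) βh)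
        _ sι Sw hS zw hzw O g) hLB hcert hε
  have hu := eventually_log_partitionFn_sector_le_of_tPrime_anchor_ceiling hn0 hn2 t U hβh 0 t' hLs hu0
  rw [sub_zero] at hu
  -- cold input `W = −β e⁺`: for every `ε > 0` eventually `(−β e⁺ − ε) L² ≤ log Z_β(t, t', U)`
  have hW : ∀ ε : ℝ, 0 < ε → ∀ᶠ j in atTop,
      (-(β * eup) - ε) * (Ls j : ℝ) ^ 2 ≤ Real.log (partitionFn β (sectorHamiltonianTT' t t' U n (Ls j))).re := by
    intro ε hε
    have hε' : 0 < ε / β := div_pos hε hβ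
    filter_upwards [eventually_neg_mul_le_log_partitionFn_sectorHamiltonianTT' t t' hU hn0 hn2 hβ.le hLs hε']
      with j hj
    refine le_trans (mul_le_mul_of_nonneg_right ?_ (by positivity)) hj
    have : β * (ε / β) = ε := by field_simp
    nlinarith [mul_le_mul_of_nonneg_left he hβ.le]
  have hmain := h.meanEnergy_hubbardTTPrime_le_of_eventually_pressure_bounds hn0 hn2.le hLs hβh hlt hW hu
  refine hmain.trans (le_of_eq ?_)
  ring

end InfVolFermionState


/-! ### Decimal-constant editions (`16/π² ≤ 16212/10000`) for row files -/

namespace InfVolFermionState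

variable {t t' U n β : ℝ} {ω : InfVolFermionState 2} {Ls : ℕ → ℕ}

/-- **Row-file edition of the transported-anchor upper edge** (same hypotheses as
`…le_of_c2Check_of_rectMarkovCertificate_tPrimeTransport_allTori`; the constant `16/π²` replaced by the decimal
`16212/10000 ≥ 16/π²`, so that a row closes by `norm_num`): `e_Φ(ω) ≤ ((c − β_h μ n) + β_h |t'| (16212/10000) − Wnum/Wden)/(β − β_h)`.
[cite: Israel1979, Lemma II.3.1] [cite: PoulinHastings2011, eqs. (3)–(8)] [cite: Lieb1973, §V (5.2)–(5.4)] -/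
theorem IsTorusLimitOfMixture.meanEnergy_hubbardTTPrime_le_of_c2Check_of_rectMarkovCertificate_tPrimeTransport_allTori'
    (hn0 : 0 ≤ n) (hn2 : n < 2)
    (h : ω.IsTorusLimitOfMixture (sectorGibbsCount n) (fun L => sectorGibbsWeightTT' β t t' U n L)
      (fun L => sectorGibbsVectorTT' t t' U n L) Ls)
    (hLs : Tendsto Ls atTop atTop) {βh : ℝ} (hβh : 0 < βh) (hlt : βh < β)
    {a b : ℕ} (ha : 1 ≤ a) (hb : 1 ≤ b) {rows : List C2Row} {P K q A₀ : ℕ} {Wnum : ℤ} {Wden : ℕ}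
    (hcheck : c2Check P K q A₀ a b rows Wnum Wden = true) (hn : n * ((q : ℝ) * a * b) = 2 * A₀)
    (hnode : ∀ r ∈ rows, r.floor ≤ (partitionFn β (spinSectorHamiltonian r.nu r.nd (hubbardOpenBoxTT' a b t t' U))).re)
    (μ : ℝ) {a' b' : ℕ} (ha' : 2 ≤ a') (hb' : 2 ≤ b')
    {ι : Type*} (sι : Finset ι) (Sw : ι → Finset (Site 2)) (hS : ∀ i, Sw i ⊆ rectWindow a' b') (zw : ι → Site 2)
    (hzw : ∀ i, shiftSet (zw i) (Sw i) ⊆ rectWindow a' b') {O : ∀ i, FermionOp (Sw i)}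
    (hO : ∀ i ∈ sι, (O i).IsHermitian) (g : ι → ℝ)
    {LB : FermionOp ((rectWindow a' b').erase (mkSite2 (a' - 1) (b' - 1)))} (hLB : LB.IsHermitian) {c : ℝ}
    (hcert : ((Real.exp c : ℂ) • cfc Real.exp LB -
      fermionPartialTrace (PolySite.incl (Finset.erase_subset (mkSite2 (a' - 1) (b' - 1)) (rectWindow a' b')))
        (cfc Real.exp (-((βh : ℂ) • (cornerEnergyRep (rectWindow a' b') (mkSite2 (a' - 1) (b' - 1)) t U μ +
            windowAnnihilator sι (rectWindow a' b') Sw hS zw hzw O g)) +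
          fermionEmbed (PolySite.incl (Finset.erase_subset (mkSite2 (a' - 1) (b' - 1)) (rectWindow a' b'))) LB))).PosSemidef) :
    ω.meanEnergy (hubbardTTPrimeFermionInteraction t t' U) 1 ≤
      ((c - βh * μ * n) + βh * |t'| * (16212 / 10000) - (Wnum : ℝ) / Wden) / (β - βh) := by
  have hmain := h.meanEnergy_hubbardTTPrime_le_of_c2Check_of_rectMarkovCertificate_tPrimeTransport_allTori hn0 hn2 hLs
    hβh hlt ha hb hcheck hn hnode μ ha' hb' sι Sw hS zw hzw hO g hLB hcert
  refine hmain.trans (div_le_div_of_nonneg_right ?_ (by linarith))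
  have hK := mul_le_mul_of_nonneg_left sixteen_div_pi_sq_lt.le (mul_nonneg hβh.le (abs_nonneg t'))
  linarith

/-- **Row-file edition of the cold-cell transported-anchor edge** (`16/π²` replaced by `16212/10000`):
`e_Φ(ω) ≤ ((c − β_h μ n) + β_h |t'| (16212/10000) + β e⁺)/(β − β_h)`.
[cite: Israel1979, Lemma II.3.1] [cite: PoulinHastings2011, eqs. (3)–(8)] [cite: Lieb1973, §V (5.2)–(5.4)] -/
theorem IsTorusLimitOfMixture.meanEnergy_hubbardTTPrime_le_of_energyDensity_le_of_rectMarkovCertificate_tPrimeTransport'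
    (hU : 0 ≤ U) (hn0 : 0 ≤ n) (hn2 : n < 2)
    (h : ω.IsTorusLimitOfMixture (sectorGibbsCount n) (fun L => sectorGibbsWeightTT' β t t' U n L)
      (fun L => sectorGibbsVectorTT' t t' U n L) Ls)
    (hLs : Tendsto Ls atTop atTop) {βh : ℝ} (hβh : 0 < βh) (hlt : βh < β)
    {eup : ℝ} (he : energyDensityTT' t t' U n ≤ eup)
    (μ : ℝ) {a' b' : ℕ} (ha' : 2 ≤ a') (hb' : 2 ≤ b')
    {ι : Type*} (sι : Finset ι) (Sw : ι → Finset (Site 2)) (hS : ∀ i, Sw i ⊆ rectWindow a' b') (zw : ι → Site 2)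
    (hzw : ∀ i, shiftSet (zw i) (Sw i) ⊆ rectWindow a' b') {O : ∀ i, FermionOp (Sw i)}
    (hO : ∀ i ∈ sι, (O i).IsHermitian) (g : ι → ℝ)
    {LB : FermionOp ((rectWindow a' b').erase (mkSite2 (a' - 1) (b' - 1)))} (hLB : LB.IsHermitian) {c : ℝ}
    (hcert : ((Real.exp c : ℂ) • cfc Real.exp LB -
      fermionPartialTrace (PolySite.incl (Finset.erase_subset (mkSite2 (a' - 1) (b' - 1)) (rectWindow a' b')))
        (cfc Real.exp (-((βh : ℂ) • (cornerEnergyRep (rectWindow a' b') (mkSite2 (a' - 1) (b' - 1)) t U μ +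
            windowAnnihilator sι (rectWindow a' b') Sw hS zw hzw O g)) +
          fermionEmbed (PolySite.incl (Finset.erase_subset (mkSite2 (a' - 1) (b' - 1)) (rectWindow a' b'))) LB))).PosSemidef) :
    ω.meanEnergy (hubbardTTPrimeFermionInteraction t t' U) 1 ≤
      ((c - βh * μ * n) + βh * |t'| * (16212 / 10000) + β * eup) / (β - βh) := by
  have hmain := h.meanEnergy_hubbardTTPrime_le_of_energyDensity_le_of_rectMarkovCertificate_tPrimeTransport hU hn0 hn2 hLs
    hβh hlt he μ ha' hb' sι Sw hS zw hzw hO g hLB hcert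
  refine hmain.trans (div_le_div_of_nonneg_right ?_ (by linarith))
  have hK := mul_le_mul_of_nonneg_left sixteen_div_pi_sq_lt.le (mul_nonneg hβh.le (abs_nonneg t'))
  linarith

end InfVolFermionState


/-! ### `t'`-BOX editions (appended): the sidecar at `s₀` and the `T = 0` row at `s₀` serve every `s` of a `t'`-interval

The C2 floor moves from `s₀` to `s` at the kinematic price `β |s − s₀| 16/π²`
(`eventually_mul_sq_le_log_partitionFn_sector_of_tPrime_sixteen_div_pi_sq`), the `t' = 0` Markov ceiling moves to `s` at `β_h |s| 16/π²`,
and a `T = 0` row moves at `16/π² |s − s₀|` (`energyDensityTT'_le_of_upperBound_tPrime_kinematic`): ONE sidecar + ONE certificate word a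
whole `t'`-box (the cuprate box `t' ∈ [−0.3, −0.2]` from the data at `t' = −1/4`). -/

namespace InfVolFermionState

variable {t t' U n β : ℝ} {ω : InfVolFermionState 2} {Ls : ℕ → ℕ}

/-- **Transport of a `(W − ε)`-shaped cold input (floor) along `t'`** (kinematic price `16/π²`): if for every `ε > 0` eventually
`(W − ε) L² ≤ log Z_{L,β}(t, s₀, U)` (`β > 0`, `0 ≤ n < 2`), then for every `ε > 0` eventually
`(W − β |s − s₀| 16/π² − ε) L² ≤ log Z_{L,β}(t, s, U)`. [cite: Lieb1973, §V (5.2)–(5.4)] [cite: LiebLoss1993, §8, Theorem 8.2] -/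
theorem eventually_mul_sq_le_log_partitionFn_sector_of_tPrime_anchor_floor (hn0 : 0 ≤ n) (hn2 : n < 2) (t U : ℝ)
    {β : ℝ} (hβ : 0 < β) (s₀ s : ℝ) (hLs : Tendsto Ls atTop atTop) {W : ℝ}
    (hW : ∀ ε : ℝ, 0 < ε → ∀ᶠ j in atTop,
      (W - ε) * (Ls j : ℝ) ^ 2 ≤ Real.log (partitionFn β (sectorHamiltonianTT' t s₀ U n (Ls j))).re) :
    ∀ ε : ℝ, 0 < ε → ∀ᶠ j in atTop,
      (W - β * |s - s₀| * (16 / Real.pi ^ 2) - ε) * (Ls j : ℝ) ^ 2 ≤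
        Real.log (partitionFn β (sectorHamiltonianTT' t s U n (Ls j))).re := by
  intro ε hε
  have hK : 0 ≤ β * |s - s₀| := mul_nonneg hβ.le (abs_nonneg _)
  set ε₂ : ℝ := ε / 2 / (β * |s - s₀| + 1) with hε₂
  have hε₂pos : 0 < ε₂ := by positivity
  have hsmall : β * |s - s₀| * ε₂ ≤ ε / 2 := by
    have hden : 0 < β * |s - s₀| + 1 := by positivity
    have : β * |s - s₀| * ε₂ = (ε / 2) * (β * |s - s₀| / (β * |s - s₀| + 1)) := by
      rw [hε₂]; field_simp
    rw [this]
    have hfrac : β * |s - s₀| / (β * |s - s₀| + 1) ≤ 1 := by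
      rw [div_le_one hden]; linarith
    nlinarith [hε.le]
  have h := eventually_mul_sq_le_log_partitionFn_sector_of_tPrime_sixteen_div_pi_sq hn0 hn2 t U hβ s₀ s hLs
    (hW (ε / 2) (by positivity)) hε₂pos
  filter_upwards [h] with j hj
  refine le_trans (mul_le_mul_of_nonneg_right ?_ (by positivity)) hj
  nlinarith [hsmall, hK]

/-- **`t'`-BOX upper edge from ONE sidecar at `s₀` and ONE `t' = 0` Markov certificate** (every torus limit at `(β, t, s, U, n)`,
`0 ≤ n < 2`, `0 < β_h < β`): with `|s| ≤ σ₁` and `|s − s₀| ≤ σ₂`,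
`e_Φ(ω) ≤ ((c − β_h μ n) + β_h σ₁ (16212/10000) + β σ₂ (16212/10000) − Wnum/Wden)/(β − β_h)`.
[cite: Israel1979, Lemma II.3.1] [cite: PoulinHastings2011, eqs. (3)–(8)] [cite: Lieb1973, §V (5.2)–(5.4)] -/
theorem IsTorusLimitOfMixture.meanEnergy_hubbardTTPrime_le_of_c2Check_of_rectMarkovCertificate_tPrimeBox_allTori
    (hn0 : 0 ≤ n) (hn2 : n < 2) {s₀ s σ₁ σ₂ : ℝ} (hσ₁ : |s| ≤ σ₁) (hσ₂ : |s - s₀| ≤ σ₂)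
    (h : ω.IsTorusLimitOfMixture (sectorGibbsCount n) (fun L => sectorGibbsWeightTT' β t s U n L)
      (fun L => sectorGibbsVectorTT' t s U n L) Ls)
    (hLs : Tendsto Ls atTop atTop) {βh : ℝ} (hβh : 0 < βh) (hlt : βh < β)
    -- C2 sidecar at `(β, t, s₀, U)`
    {a b : ℕ} (ha : 1 ≤ a) (hb : 1 ≤ b) {rows : List C2Row} {P K q A₀ : ℕ} {Wnum : ℤ} {Wden : ℕ}
    (hcheck : c2Check P K q A₀ a b rows Wnum Wden = true) (hn : n * ((q : ℝ) * a * b) = 2 * A₀)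
    (hnode : ∀ r ∈ rows, r.floor ≤ (partitionFn β (spinSectorHamiltonian r.nu r.nd (hubbardOpenBoxTT' a b t s₀ U))).re)
    -- C1 at `(βh, t, 0, U)`
    (μ : ℝ) {a' b' : ℕ} (ha' : 2 ≤ a') (hb' : 2 ≤ b')
    {ι : Type*} (sι : Finset ι) (Sw : ι → Finset (Site 2)) (hS : ∀ i, Sw i ⊆ rectWindow a' b') (zw : ι → Site 2)
    (hzw : ∀ i, shiftSet (zw i) (Sw i) ⊆ rectWindow a' b') {O : ∀ i, FermionOp (Sw i)}
    (hO : ∀ i ∈ sι, (O i).IsHermitian) (g : ι → ℝ)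
    {LB : FermionOp ((rectWindow a' b').erase (mkSite2 (a' - 1) (b' - 1)))} (hLB : LB.IsHermitian) {c : ℝ}
    (hcert : ((Real.exp c : ℂ) • cfc Real.exp LB -
      fermionPartialTrace (PolySite.incl (Finset.erase_subset (mkSite2 (a' - 1) (b' - 1)) (rectWindow a' b')))
        (cfc Real.exp (-((βh : ℂ) • (cornerEnergyRep (rectWindow a' b') (mkSite2 (a' - 1) (b' - 1)) t U μ +
            windowAnnihilator sι (rectWindow a' b') Sw hS zw hzw O g)) +
          fermionEmbed (PolySite.incl (Finset.erase_subset (mkSite2 (a' - 1) (b' - 1)) (rectWindow a' b'))) LB))).PosSemidef) :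
    ω.meanEnergy (hubbardTTPrimeFermionInteraction t s U) 1 ≤
      ((c - βh * μ * n) + βh * σ₁ * (16212 / 10000) + β * σ₂ * (16212 / 10000) - (Wnum : ℝ) / Wden) / (β - βh) := by
  obtain ⟨hnd, hq, hmS, hsum, hA, hB, hz0, harith⟩ := c2Check_sound hcheck ha hb
  have hz := c2Floor_le_of_rows hnd
    (F := fun s => (partitionFn β (spinSectorHamiltonian s.1 s.2 (hubbardOpenBoxTT' a b t s₀ U))).re)
    (fun r hr => hnode r hr)
  have hβ : 0 < β := hβh.trans hlt
  have hKTI : ∀ (L : ℕ) [NeZero L], ∀ w : TorusSite 2 L,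
      relabel (Orb.translate w) (hubbardTorusTT' L t 0 U - (μ : ℂ) • totalNumber) =
        hubbardTorusTT' L t 0 U - (μ : ℂ) • totalNumber := fun L _ w => by
    rw [hubbardTorusTT'_zero_sub_mu, relabel_translate_hubbardTorusWith]
  have hu0 : ∀ ε : ℝ, 0 < ε → ∀ᶠ j in atTop,
      Real.log (partitionFn βh (sectorHamiltonianTT' t 0 U n (Ls j))).re ≤ ((c - βh * μ * n) + ε) * (Ls j : ℝ) ^ 2 :=
    fun ε hε => eventually_log_partitionFn_sectorHamiltonianTT'_le_of_clusterCertificate t U μ βh hn0 hn2.le hLs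
      (rectCorner_mem_rectWindow (by omega) (by omega)) toLex_le_toLex_rectCorner
      (rectWindow_subset_halfOpenBox_max a' b')
      (fun i => bondWeightSum_cornerBondWeight (rectCorner_mem_rectWindow (by omega) (by omega))
        (rectCorner_sub_unitVec_mem_rectWindow ha' hb' i))
      (siteWeightSum_cornerSiteWeight (rectCorner_mem_rectWindow (by omega) (by omega)))
      (siteWeightSum_mul_cornerSiteWeight (rectCorner_mem_rectWindow (by omega) (by omega)) (-μ))
      (isHermitian_windowAnnihilator sι _ Sw hS zw hzw hO g)
      (fun L _ hL3 hℓL => trace_window_mul_windowAnnihilator (relabel_translate_gibbsDensity L (hKTI L) βh)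
        _ sι Sw hS zw hzw O g) hLB hcert hε
  have hu := eventually_log_partitionFn_sector_le_of_tPrime_anchor_ceiling hn0 hn2 t U hβh 0 s hLs hu0
  rw [sub_zero] at hu
  set W : ℝ := ((q : ℝ) * Real.log q - ∑ x ∈ c2Sectors rows, (c2Type rows x : ℝ) * Real.log (c2Type rows x) +
    ∑ x ∈ c2Sectors rows, (c2Type rows x : ℝ) * Real.log (c2Floor rows x)) / ((q : ℝ) * a * b) with hWdef
  have hW0 : ∀ ε : ℝ, 0 < ε → ∀ᶠ j in atTop,
      (W - ε) * (Ls j : ℝ) ^ 2 ≤ Real.log (partitionFn β (sectorHamiltonianTT' t s₀ U n (Ls j))).re :=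
    fun ε hε => eventually_typeFreeEntropy_mul_sq_le_log_partitionFn_allTori t s₀ U n hβ.le ha hb
      (c2Sectors rows) (c2Type rows) hq hmS hsum hA hB hn hn2.le hz0 hz hLs hε
  have hWs := eventually_mul_sq_le_log_partitionFn_sector_of_tPrime_anchor_floor hn0 hn2 t U hβ s₀ s hLs hW0
  have hmain := h.meanEnergy_hubbardTTPrime_le_of_eventually_pressure_bounds hn0 hn2.le hLs hβh hlt hWs hu
  refine hmain.trans (div_le_div_of_nonneg_right ?_ (by linarith))
  have hK := sixteen_div_pi_sq_lt.le
  have h1 : βh * |s| * (16 / Real.pi ^ 2) ≤ βh * σ₁ * (16212 / 10000) :=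
    mul_le_mul (mul_le_mul_of_nonneg_left hσ₁ hβh.le) hK (by positivity) (mul_nonneg hβh.le ((abs_nonneg s).trans hσ₁))
  have h2 : β * |s - s₀| * (16 / Real.pi ^ 2) ≤ β * σ₂ * (16212 / 10000) :=
    mul_le_mul (mul_le_mul_of_nonneg_left hσ₂ hβ.le) hK (by positivity) (mul_nonneg hβ.le ((abs_nonneg _).trans hσ₂))
  linarith

/-- **`t'`-BOX cold-cell edge: `T = 0` row at `s₀` + `t' = 0` Markov certificate, both transported to `s`** (`U ≥ 0`, `0 ≤ n < 2`,
`0 < β_h < β`, `|s| ≤ σ₁`, `|s − s₀| ≤ σ₂`, `e(t, s₀, U, n) ≤ e⁺`):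
`e_Φ(ω) ≤ ((c − β_h μ n) + β_h σ₁ (16212/10000) + β (e⁺ + (16212/10000) σ₂))/(β − β_h)`.
[cite: Israel1979, Lemma II.3.1] [cite: PoulinHastings2011, eqs. (3)–(8)] [cite: Lieb1973, §V (5.2)–(5.4)] -/
theorem IsTorusLimitOfMixture.meanEnergy_hubbardTTPrime_le_of_energyDensity_le_of_rectMarkovCertificate_tPrimeBox
    (hU : 0 ≤ U) (hn0 : 0 ≤ n) (hn2 : n < 2) {s₀ s σ₁ σ₂ : ℝ} (hσ₁ : |s| ≤ σ₁) (hσ₂ : |s - s₀| ≤ σ₂)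
    (h : ω.IsTorusLimitOfMixture (sectorGibbsCount n) (fun L => sectorGibbsWeightTT' β t s U n L)
      (fun L => sectorGibbsVectorTT' t s U n L) Ls)
    (hLs : Tendsto Ls atTop atTop) {βh : ℝ} (hβh : 0 < βh) (hlt : βh < β)
    {eup : ℝ} (he : energyDensityTT' t s₀ U n ≤ eup)
    (μ : ℝ) {a' b' : ℕ} (ha' : 2 ≤ a') (hb' : 2 ≤ b')
    {ι : Type*} (sι : Finset ι) (Sw : ι → Finset (Site 2)) (hS : ∀ i, Sw i ⊆ rectWindow a' b') (zw : ι → Site 2)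
    (hzw : ∀ i, shiftSet (zw i) (Sw i) ⊆ rectWindow a' b') {O : ∀ i, FermionOp (Sw i)}
    (hO : ∀ i ∈ sι, (O i).IsHermitian) (g : ι → ℝ)
    {LB : FermionOp ((rectWindow a' b').erase (mkSite2 (a' - 1) (b' - 1)))} (hLB : LB.IsHermitian) {c : ℝ}
    (hcert : ((Real.exp c : ℂ) • cfc Real.exp LB -
      fermionPartialTrace (PolySite.incl (Finset.erase_subset (mkSite2 (a' - 1) (b' - 1)) (rectWindow a' b')))
        (cfc Real.exp (-((βh : ℂ) • (cornerEnergyRep (rectWindow a' b') (mkSite2 (a' - 1) (b' - 1)) t U μ +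
            windowAnnihilator sι (rectWindow a' b') Sw hS zw hzw O g)) +
          fermionEmbed (PolySite.incl (Finset.erase_subset (mkSite2 (a' - 1) (b' - 1)) (rectWindow a' b'))) LB))).PosSemidef) :
    ω.meanEnergy (hubbardTTPrimeFermionInteraction t s U) 1 ≤
      ((c - βh * μ * n) + βh * σ₁ * (16212 / 10000) + β * (eup + (16212 / 10000) * σ₂)) / (β - βh) := by
  have hβ : 0 < β := hβh.trans hlt
  -- the `T = 0` row transported to `s`
  have he' : energyDensityTT' t s U n ≤ eup + 16 / Real.pi ^ 2 * |s - s₀| :=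
    energyDensityTT'_le_of_upperBound_tPrime_kinematic t hU hn0 hn2 he
  have hmain := h.meanEnergy_hubbardTTPrime_le_of_energyDensity_le_of_rectMarkovCertificate_tPrimeTransport' hU hn0 hn2 hLs
    hβh hlt he' μ ha' hb' sι Sw hS zw hzw hO g hLB hcert
  refine hmain.trans (div_le_div_of_nonneg_right ?_ (by linarith))
  have hK := sixteen_div_pi_sq_lt.le
  have h1 : βh * |s| * (16212 / 10000 : ℝ) ≤ βh * σ₁ * (16212 / 10000) := by
    have := mul_le_mul_of_nonneg_left hσ₁ hβh.le
    nlinarith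
  have h2 : β * (16 / Real.pi ^ 2 * |s - s₀|) ≤ β * ((16212 / 10000) * σ₂) :=
    mul_le_mul_of_nonneg_left (mul_le_mul hK hσ₂ (abs_nonneg _) (by positivity)) hβ.le
  nlinarith [h1, h2, mul_le_mul_of_nonneg_left he' hβ.le]

end InfVolFermionState

end Literature.MathematicalPhysics.QuantumLattice

end
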